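import Summits.ABC.StewartYu.PadicW80ParL
import HarnessLib

/-!
# The `(log p)`-normalised parameter record `PadicW80ParL` — part A of the inequalities

Support file (theorems only; no named facts), cell `abc-stewartyu` (p1, stub S5 of memo-03 §4). Twin of the
theorem part of `PadicW80Par.lean`: the floors `≥ 1` recovered from the floors `≥ ℓ`, the normalised sizes
`nV, nV_θ, nW⋆, nG ≥ 1`, `W⋆ ≥ 9m`, `G ≥ 11m`, `ℓ ≤ G ≤ 3W⋆`, `0 < U`, the size of the unit
`U/(2ᵐW⋆) ≥ 2^{49m}·nG·(∏nV)nV_θ`, `S₀` even with `c_S m nW⋆ ≤ S₀ ≤ 2c_S m nW⋆`, `1 ≤ T ≤ U/(c_T 2ᵐ W⋆)`,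
`L_θ ≤ U/(c_L' m 2^{m+1} S₀ V_θ)`. Proofs are the landed ones (`PadicW80Par.lean`) with `(V, V_θ, G) ↦ (nV, nV_θ, nG)`
inside `U` and `W⋆ ↦ nW⋆` inside `S₀`; design note HOME/p1/S5-logp-ledger.md.

## References
* [Yu1990] K. Yu, *Linear forms in p-adic logarithms II*, Compositio Math. 74 (1990), (2.8)–(2.13), (2.30)–(2.31).
* [Waldschmidt1980] M. Waldschmidt, Acta Arith. 37 (1980), §3.2 (pp. 264–265).
-/

noncomputable section

open Finset Real
open Literature.NumberTheory.Transcendental Literature.NumberTheory.Transcendental.Waldschmidt1980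

namespace Summit.ABC.StewartYu

open PadicW80Par (cTp cSp cLp cLp' Ap mRp)

namespace PadicW80ParL

variable {d : ℕ} (P : PadicW80ParL d)

/-! ### The old floors `≥ 1` (so that the landed proofs apply verbatim) -/

/-- `Vⱼ ≥ 1`. [folklore] -/
theorem hV (j : Fin d) : 1 ≤ P.V j := P.hℓ.trans (P.hVℓ j)

/-- `1 ≤ V_θ`. [folklore] -/
theorem hVθ1 : 1 ≤ P.Vθ := P.hℓ.trans P.hVθℓ

/-- `1 ≤ V_max`. [folklore] -/
theorem hVmax1 : 1 ≤ P.Vm := P.hVθ1.trans P.hVθmax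

/-- `1 ≤ W`. [folklore] -/
theorem hW : 1 ≤ P.W := P.hℓ.trans P.hWℓ

/-- `0 < ℓ`. [folklore] -/
theorem ℓ_pos : 0 < P.ℓ := lt_of_lt_of_le one_pos P.hℓ

/-- `ℓ ≤ V_max`. [folklore] -/
theorem ℓ_le_Vmax : P.ℓ ≤ P.Vm := P.hVθℓ.trans P.hVθmax

/-- `1 ≤ nVⱼ`. [folklore] -/
theorem one_le_nV (j : Fin d) : 1 ≤ P.nV j := by
  unfold nV; rw [le_div_iff₀ P.ℓ_pos, one_mul]; exact P.hVℓ j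

/-- `1 ≤ nV_θ`. [folklore] -/
theorem one_le_nVθ : 1 ≤ P.nVθ := by
  unfold nVθ; rw [le_div_iff₀ P.ℓ_pos, one_mul]; exact P.hVθℓ

/-- `Vⱼ = ℓ · nVⱼ`. [folklore] -/
theorem V_eq (j : Fin d) : P.V j = P.ℓ * P.nV j := by
  unfold nV; field_simp [P.ℓ_pos.ne']

/-- `V_θ = ℓ · nV_θ`. [folklore] -/
theorem Vθ_eq : P.Vθ = P.ℓ * P.nVθ := by
  unfold nVθ; field_simp [P.ℓ_pos.ne']

/-- `nVⱼ ≤ Vⱼ` (`ℓ ≥ 1`). [folklore] -/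
theorem nV_le (j : Fin d) : P.nV j ≤ P.V j := by
  unfold nV; exact div_le_self (by linarith [P.hV j]) P.hℓ

/-- `nV_θ ≤ V_θ`. [folklore] -/
theorem nVθ_le : P.nVθ ≤ P.Vθ := by
  unfold nVθ; exact div_le_self (by linarith [P.hVθ1]) P.hℓ


/-! ### Elementary inequalities -/

/-- `1 ≤ m`, `2 ≤ m`. [folklore] -/
theorem two_le_mR (P : PadicW80ParL d) : (2 : ℝ) ≤ mRp d := by
  have h1 : (1 : ℝ) ≤ d := by exact_mod_cast P.hd
  unfold PadicW80Par.mRp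
  linarith

/-- `0 < m`. [folklore] -/
theorem mR_pos (P : PadicW80ParL d) : (0 : ℝ) < mRp d := by linarith [(two_le_mR P)]

/-- `1 ≤ V_max`. [folklore] -/
theorem one_le_Vmax : (1 : ℝ) ≤ P.Vm := P.hVmax1

/-- `W⋆ ≥ W ≥ 1`. [folklore] -/
theorem W_le_Wstar : P.W ≤ P.Wstarℓ := le_max_left _ _

/-- `1 ≤ W⋆`. [folklore] -/
theorem one_le_Wstar : (1 : ℝ) ≤ P.Wstarℓ := P.hW.trans P.W_le_Wstar

/-- `ℓ ≤ W⋆`. [folklore] -/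
theorem ℓ_le_Wstar : P.ℓ ≤ P.Wstarℓ := P.hWℓ.trans P.W_le_Wstar

/-- `1 ≤ nW⋆`. [folklore] -/
theorem one_le_nWstar : (1 : ℝ) ≤ P.nWstarℓ := by
  unfold nWstarℓ; rw [le_div_iff₀ P.ℓ_pos, one_mul]; exact P.ℓ_le_Wstar

/-- `W⋆ = ℓ · nW⋆`. [folklore] -/
theorem Wstar_eq : P.Wstarℓ = P.ℓ * P.nWstarℓ := by
  unfold nWstarℓ; field_simp [P.ℓ_pos.ne']

/-- `W⋆ ≥ m log(2¹³ m V_θ)`. [folklore] -/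
theorem mlog_le_Wstar : mRp d * Real.log (2 ^ 13 * mRp d * P.Vm) ≤ P.Wstarℓ := le_max_right _ _

/-- `log(2¹³ m V_θ) ≥ 9` (`2¹³ · 2 = 2¹⁴ ≥ e⁹`). [folklore] -/
theorem nine_le_log : (9 : ℝ) ≤ Real.log (2 ^ 13 * mRp d * P.Vm) := by
  have h1 : (2 : ℝ) ^ 14 ≤ 2 ^ 13 * mRp d * P.Vm := by
    have := (two_le_mR P); have := P.hVmax1
    calc (2 : ℝ) ^ 14 = 2 ^ 13 * 2 * 1 := by norm_num
      _ ≤ 2 ^ 13 * mRp d * P.Vm := by gcongr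
  have h2 : Real.exp 9 ≤ (2 : ℝ) ^ 14 := by
    have := Real.exp_one_lt_d9
    calc Real.exp 9 = Real.exp 1 ^ 9 := by rw [← Real.exp_nat_mul]; norm_num
      _ ≤ (2.7182818286 : ℝ) ^ 9 := by gcongr
      _ ≤ 2 ^ 14 := by norm_num
  calc (9 : ℝ) = Real.log (Real.exp 9) := (Real.log_exp 9).symm
    _ ≤ Real.log (2 ^ 13 * mRp d * P.Vm) := Real.log_le_log (Real.exp_pos _) (h2.trans h1)

/-- `W⋆ ≥ 9m ≥ 18`. [folklore] -/
theorem nine_mR_le_Wstar : 9 * mRp d ≤ P.Wstarℓ := by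
  have h := P.mlog_le_Wstar
  have h9 := P.nine_le_log
  have hm := (mR_pos P)
  nlinarith

/-- `log(2¹⁷ m V_f) ≥ 11` (`2¹⁸ ≥ e¹¹`). [folklore] -/
theorem eleven_le_logG : (11 : ℝ) ≤ Real.log (2 ^ 17 * mRp d * P.Vm) := by
  have h1 : (2 : ℝ) ^ 18 ≤ 2 ^ 17 * mRp d * P.Vm := by
    have := (two_le_mR P); have := P.hVmax1
    calc (2 : ℝ) ^ 18 = 2 ^ 17 * 2 * 1 := by norm_num
      _ ≤ 2 ^ 17 * mRp d * P.Vm := by gcongr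
  have h2 : Real.exp 11 ≤ (2 : ℝ) ^ 18 := by
    have := Real.exp_one_lt_d9
    calc Real.exp 11 = Real.exp 1 ^ 11 := by rw [← Real.exp_nat_mul]; norm_num
      _ ≤ (2.7182818286 : ℝ) ^ 11 := by gcongr
      _ ≤ 2 ^ 18 := by norm_num
  calc (11 : ℝ) = Real.log (Real.exp 11) := (Real.log_exp 11).symm
    _ ≤ Real.log (2 ^ 17 * mRp d * P.Vm) := Real.log_le_log (Real.exp_pos _) (h2.trans h1)

/-- The un-floored part of `G`: `m log(2¹⁷ m V_max) ≤ G`. [folklore] -/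
theorem mlogG_le_G : mRp d * Real.log (2 ^ 17 * mRp d * P.Vm) ≤ P.Gℓ := by
  unfold Gℓ; linarith [P.ℓ_pos]

/-- `G ≥ 11 m ≥ 22`. [folklore] -/
theorem eleven_mR_le_G : 11 * mRp d ≤ P.Gℓ := by
  have h := P.mlogG_le_G; have := P.eleven_le_logG; have := (mR_pos P); nlinarith

/-- `0 < G`. [folklore] -/
theorem G_pos : 0 < P.Gℓ := by have := P.eleven_mR_le_G; have := (mR_pos P); nlinarith

/-- The floor `ℓ ≤ G`. [cite: Yu1990, (2.10) (p. 31)] -/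
theorem ℓ_le_G : P.ℓ ≤ P.Gℓ := by
  unfold Gℓ
  have h := P.eleven_le_logG; have hm := (mR_pos P)
  nlinarith

/-- `1 ≤ nG`. [folklore] -/
theorem one_le_nG : (1 : ℝ) ≤ P.nGℓ := by
  unfold nGℓ; rw [le_div_iff₀ P.ℓ_pos, one_mul]; exact P.ℓ_le_G

/-- `G = ℓ · nG`. [folklore] -/
theorem G_eq : P.Gℓ = P.ℓ * P.nGℓ := by
  unfold nGℓ; field_simp [P.ℓ_pos.ne']

/-- `0 < nG`. [folklore] -/
theorem nG_pos : 0 < P.nGℓ := lt_of_lt_of_le one_pos P.one_le_nG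

/-- **`G ≤ 3 W⋆`**: `2¹⁷ m V_f ≤ (2¹³ m V_θ)²` and `ℓ ≤ W⋆`. [folklore] -/
theorem G_le_three_Wstar : P.Gℓ ≤ 3 * P.Wstarℓ := by
  have hm := (two_le_mR P)
  have hVθ := P.hVmax1
  have h1 : (2 : ℝ) ^ 17 * mRp d * P.Vm ≤ (2 ^ 13 * mRp d * P.Vm) ^ 2 := by
    have hVf0 : P.Vm ≤ P.Vm := le_rfl
    have hm1 : 1 ≤ mRp d := by linarith
    have hVf1 := P.hVmax1
    have e : (2 ^ 13 * mRp d * P.Vm) ^ 2 = (2 : ℝ) ^ 26 * ((mRp d * mRp d) * (P.Vm * P.Vm)) := by ring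
    rw [e]
    have h2 : mRp d * P.Vm ≤ (mRp d * mRp d) * (P.Vm * P.Vm) := by
      calc mRp d * P.Vm ≤ mRp d * P.Vm := mul_le_mul_of_nonneg_left hVf0 (by linarith)
        _ = (mRp d * 1) * (P.Vm * 1) := by ring
        _ ≤ (mRp d * mRp d) * (P.Vm * P.Vm) := by gcongr
    calc (2 : ℝ) ^ 17 * mRp d * P.Vm = 2 ^ 17 * (mRp d * P.Vm) := by ring
      _ ≤ 2 ^ 26 * (mRp d * P.Vm) := by gcongr <;> norm_num
      _ ≤ 2 ^ 26 * ((mRp d * mRp d) * (P.Vm * P.Vm)) := by gcongr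
  have hpos : (0 : ℝ) < 2 ^ 17 * mRp d * P.Vm := by have := P.hVmax1; positivity
  have hℓW := P.ℓ_le_Wstar
  calc P.Gℓ = mRp d * Real.log (2 ^ 17 * mRp d * P.Vm) + P.ℓ := rfl
    _ ≤ mRp d * Real.log ((2 ^ 13 * mRp d * P.Vm) ^ 2) + P.ℓ := by
        have := mul_le_mul_of_nonneg_left (Real.log_le_log hpos h1) (mR_pos P).le
        linarith
    _ = 2 * (mRp d * Real.log (2 ^ 13 * mRp d * P.Vm)) + P.ℓ := by rw [Real.log_pow]; push_cast; ring
    _ ≤ 2 * P.Wstarℓ + P.Wstarℓ := by linarith [P.mlog_le_Wstar]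
    _ = 3 * P.Wstarℓ := by ring

/-- `1 ≤ ∏ nVⱼ`. [folklore] -/
theorem one_le_prodnV : (1 : ℝ) ≤ ∏ j, P.nV j := by
  have : ∏ _j : Fin d, (1 : ℝ) ≤ ∏ j, P.nV j :=
    prod_le_prod (fun _ _ => zero_le_one) fun j _ => P.one_le_nV j
  simpa using this

/-- `0 < U`. [folklore] -/
theorem U_pos : 0 < P.Uℓ := by
  unfold Uℓ PadicW80Par.Ap
  have := P.one_le_Wstar; have := P.nG_pos; have := P.one_le_nVθ; have := (mR_pos P); have := P.hMcl
  have hV : 0 < ∏ j, P.nV j := prod_pos fun j _ => lt_of_lt_of_le one_pos (P.one_le_nV j)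
  positivity

/-- **The size of the unit `U/2ᵐ`**: `U/(2ᵐ W⋆) ≥ 2^{49m} · nG · (∏ nVⱼ) nV_θ ≥ 2^{49m}`
(`m^{2m+1}/m! ≥ 1`, `Mcl ≥ 1`). [folklore] -/
theorem U_div_ge : (2 : ℝ) ^ (49 * (d + 1)) * P.nGℓ * ((∏ j, P.nV j) * P.nVθ) * P.Wstarℓ ≤ P.Uℓ / 2 ^ (d + 1) := by
  unfold Uℓ PadicW80Par.Ap
  rw [le_div_iff₀ (by positivity)]
  have hfac : (1 : ℝ) ≤ mRp d ^ (2 * d + 3) / (d + 1).factorial := by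
    rw [le_div_iff₀ (by positivity), one_mul]
    have h1 : ((d + 1).factorial : ℝ) ≤ ((d + 1 : ℕ) : ℝ) ^ (d + 1) := by
      exact_mod_cast Nat.factorial_le_pow (d + 1)
    have h2 : ((d + 1 : ℕ) : ℝ) ^ (d + 1) ≤ mRp d ^ (2 * d + 3) := by
      have hm : ((d + 1 : ℕ) : ℝ) = mRp d := by unfold PadicW80Par.mRp; push_cast; ring
      rw [hm]
      exact pow_le_pow_right₀ (by linarith [(two_le_mR P)]) (by omega)
    exact h1.trans h2
  have hW := P.one_le_Wstar; have hG := P.nG_pos; have hVθ := P.one_le_nVθ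
  have hV : 1 ≤ ∏ j, P.nV j := P.one_le_prodnV
  have hVV : 0 ≤ (∏ j, P.nV j) * P.nVθ := by positivity
  have hpow : (2 : ℝ) ^ (49 * (d + 1)) * 2 ^ (d + 1) = (2 ^ 50) ^ (d + 1) := by
    rw [← pow_mul, ← pow_add]; congr 1; ring
  have hM := P.hMcl
  calc (2 : ℝ) ^ (49 * (d + 1)) * P.nGℓ * ((∏ j, P.nV j) * P.nVθ) * P.Wstarℓ * 2 ^ (d + 1)
      = 1 * (2 ^ 50) ^ (d + 1) * 1 * ((∏ j, P.nV j) * P.nVθ) * P.Wstarℓ * P.nGℓ := by rw [← hpow]; ring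
    _ ≤ P.Mcl * (2 ^ 50) ^ (d + 1) * (mRp d ^ (2 * d + 3) / (d + 1).factorial) * ((∏ j, P.nV j) * P.nVθ) *
          P.Wstarℓ * P.nGℓ := by gcongr

/-- `U/(2ᵐ W⋆) ≥ 2^{49m}` (a convenient weak form). [folklore] -/
theorem U_div_ge' : (2 : ℝ) ^ (49 * (d + 1)) ≤ P.Uℓ / (2 ^ (d + 1) * P.Wstarℓ) := by
  have h := P.U_div_ge
  have hW := P.one_le_Wstar
  have hG : 1 ≤ P.nGℓ := P.one_le_nG
  have hV : 1 ≤ (∏ j, P.nV j) * P.nVθ := by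
    have h1 : 1 ≤ ∏ j, P.nV j := P.one_le_prodnV
    nlinarith [P.one_le_nVθ]
  rw [le_div_iff₀ (by positivity)]
  rw [le_div_iff₀ (by positivity)] at h
  have h49 : (0 : ℝ) ≤ 2 ^ (49 * (d + 1)) := by positivity
  calc (2 : ℝ) ^ (49 * (d + 1)) * (2 ^ (d + 1) * P.Wstarℓ)
      = 2 ^ (49 * (d + 1)) * 1 * 1 * P.Wstarℓ * 2 ^ (d + 1) := by ring
    _ ≤ 2 ^ (49 * (d + 1)) * P.nGℓ * ((∏ j, P.nV j) * P.nVθ) * P.Wstarℓ * 2 ^ (d + 1) := by gcongr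
    _ ≤ P.Uℓ := h

/-! ### `S₀` -/

/-- `S₀` is even. [folklore] -/
theorem even_S₀ : Even P.S₀ℓ := ⟨⌊cSp * mRp d * P.nWstarℓ⌋₊, by unfold S₀ℓ; ring⟩

/-- `c_S m nW⋆ ≥ 2¹⁴`. [folklore] -/
theorem cS_mul_ge : (2 : ℝ) ^ 14 ≤ cSp * mRp d * P.nWstarℓ := by
  unfold PadicW80Par.cSp
  have := (two_le_mR P); have := P.one_le_nWstar
  calc (2 : ℝ) ^ 14 ≤ 2 ^ 15 * 2 * 1 := by norm_num
    _ ≤ 2 ^ 15 * mRp d * P.nWstarℓ := by gcongr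

/-- `S₀ ≤ 2 c_S m nW⋆`. [folklore] -/
theorem S₀_le : (P.S₀ℓ : ℝ) ≤ 2 * (cSp * mRp d * P.nWstarℓ) := by
  unfold S₀ℓ
  push_cast
  have := Nat.floor_le (show 0 ≤ cSp * mRp d * P.nWstarℓ by have := P.cS_mul_ge; linarith)
  linarith

/-- `c_S m nW⋆ ≤ S₀` (indeed `S₀ ≥ 2 c_S m nW⋆ − 2`). [folklore] -/
theorem S₀_ge : cSp * mRp d * P.nWstarℓ ≤ P.S₀ℓ := by
  unfold S₀ℓ
  push_cast
  have h1 := Nat.lt_floor_add_one (cSp * mRp d * P.nWstarℓ)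
  have h2 := P.cS_mul_ge
  linarith

/-- `2 ≤ S₀`. [folklore] -/
theorem two_le_S₀ : 2 ≤ P.S₀ℓ := by
  have h := P.S₀_ge
  have h2 := P.cS_mul_ge
  have : (2 : ℝ) ≤ P.S₀ℓ := by linarith
  exact_mod_cast this

/-- `0 < S₀` (real). [folklore] -/
theorem S₀_pos : (0 : ℝ) < P.S₀ℓ := by have := P.two_le_S₀; exact_mod_cast (by omega : 0 < P.S₀ℓ)

/-! ### `T` -/

/-- `T ≤ U/(c_T 2ᵐ W⋆)`. [folklore] -/
theorem T_le : (P.Tℓ : ℝ) ≤ P.Uℓ / (cTp * 2 ^ (d + 1) * P.Wstarℓ) := by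
  unfold Tℓ
  exact Nat.floor_le (by unfold PadicW80Par.cTp; have := P.U_pos; have := P.one_le_Wstar; positivity)

/-- `U/(c_T 2ᵐ W⋆) ≥ 2`. [folklore] -/
theorem two_le_U_div_cT : (2 : ℝ) ≤ P.Uℓ / (cTp * 2 ^ (d + 1) * P.Wstarℓ) := by
  have h := P.U_div_ge'
  have hW := P.one_le_Wstar
  unfold PadicW80Par.cTp
  rw [le_div_iff₀ (by positivity)]
  rw [le_div_iff₀ (by positivity)] at h
  have h50 : (2 : ℝ) * 2 ^ 14 ≤ 2 ^ (49 * (d + 1)) := by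
    calc (2 : ℝ) * 2 ^ 14 = 2 ^ 15 := by norm_num
      _ ≤ 2 ^ (49 * (d + 1)) := pow_le_pow_right₀ (by norm_num) (by omega)
  calc (2 : ℝ) * (2 ^ 14 * 2 ^ (d + 1) * P.Wstarℓ) = (2 * 2 ^ 14) * (2 ^ (d + 1) * P.Wstarℓ) := by ring
    _ ≤ 2 ^ (49 * (d + 1)) * (2 ^ (d + 1) * P.Wstarℓ) := by gcongr
    _ ≤ P.Uℓ := h

/-- `U/(2 c_T 2ᵐ W⋆) ≤ T` (the floor costs at most a factor `2`). [folklore] -/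
theorem T_ge : P.Uℓ / (cTp * 2 ^ (d + 1) * P.Wstarℓ) / 2 ≤ P.Tℓ := by
  unfold Tℓ
  have h1 := Nat.lt_floor_add_one (P.Uℓ / (cTp * 2 ^ (d + 1) * P.Wstarℓ))
  have h2 := P.two_le_U_div_cT
  linarith

/-- `1 ≤ T`. [folklore] -/
theorem one_le_T : 1 ≤ P.Tℓ := by
  have h := P.T_ge
  have h2 := P.two_le_U_div_cT
  have : (1 : ℝ) ≤ P.Tℓ := by linarith
  exact_mod_cast this

/-! ### `L_θ` -/

/-- The denominator of `L_θ` is positive. [folklore] -/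
theorem den_Lθ_pos : 0 < cLp' * mRp d * 2 ^ (d + 2) * P.S₀ℓ * P.Vθ := by
  unfold PadicW80Par.cLp'; have := (mR_pos P); have := P.S₀_pos; have := P.hVθ1; positivity

/-- `L_θ ≤ U/(c_L' m 2^{m+1} S₀ V_θ)`. [folklore] -/
theorem Lθ_le : (P.Lθℓ : ℝ) ≤ P.Uℓ / (cLp' * mRp d * 2 ^ (d + 2) * P.S₀ℓ * P.Vθ) := by
  unfold Lθℓ
  exact Nat.floor_le (div_nonneg P.U_pos.le P.den_Lθ_pos.le)

end PadicW80ParL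

end Summit.ABC.StewartYu

end
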